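import Mathlib
import HarnessLib

/-!
# Route TwistAmplification — crux `SomeWindowSaving` (stmt-ABC-1976), line `Sketch`: stub B1

First-derivative sublevel-set estimate for the normalized cubic `p(s) = 4s³ − G₂ s − G₃` with
`|G₂|, |G₃| ≤ 1` and discriminant `D = G₂³ − 27 G₃²`: the thin slice
`T = {s ∈ [−2,2] : 0 < p(s) < η}` has Lebesgue measure `≤ 258 η / |D|` whenever `η ≤ |D| / 126`.

Root-free proof.
* Resultant identity `(−18 G₂ s + 27 G₃)·p(s) + (6 G₂ s² − 9 G₃ s − G₂²)·p'(s) = D` with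
  `p'(s) = 12 s² − G₂`; on `[−2,2]` the two cofactors are bounded by `63` and `43`, so on the slice
  (`|p| < η ≤ |D|/126`) one gets `|D| ≤ 86 |p'(s)|`.
* `p` is monotone on each of the three order-connected pieces `{s ≤ 0, p' > 0}`, `{p' < 0}`,
  `{0 ≤ s, p' > 0}`, which cover the slice (there `p' ≠ 0`).
* Generic step: inside one such piece any two points of the slice span a segment contained in the
  slice, so by the mean value theorem they are at distance `≤ η / K` when `|p'| ≥ K` on the slice;
  `volume ≤ ediam` (`Real.volume_le_diam`) and subadditivity give `3 · 86 = 258`.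

Main statement: `Summit.ABC.ABC.Theorems.stub_sublevelSmall` (constants `c₁ = 1/126`, `C₁ = 258`).
-/

noncomputable section

open MeasureTheory Set

-- `Summit.<Summit>.<Problem>` is the mandated summit-side namespace; the duplicate `ABC.ABC` is
-- deliberate.
set_option linter.dupNamespace false

namespace Summit.ABC.ABC.Theorems

/-! ### Generic part: a sublevel slice of a differentiable function inside a monotonicity piece -/

/-- Core length bound.  Let `p` have derivative `p'` everywhere, `S` and `J` be order-connected,
`p` monotone or antitone on `J`, and `|p'| ≥ K > 0` on the slice `T = {s ∈ S : 0 < p s < η}`.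
Then two points `a < b` of `T ∩ J` satisfy `b − a ≤ η / K` (mean value theorem on `[a, b] ⊆ T`). -/
private theorem SublevelSmall.sub_le {p p' : ℝ → ℝ} {S J : Set ℝ} {η K : ℝ} (hK : 0 < K)
    (hp : ∀ x, HasDerivAt p (p' x) x) (hS : S.OrdConnected) (hJ : J.OrdConnected)
    (hmono : MonotoneOn p J ∨ AntitoneOn p J)
    (hder : ∀ s ∈ {s : ℝ | s ∈ S ∧ 0 < p s ∧ p s < η}, K ≤ |p' s|) {a b : ℝ}
    (ha : a ∈ {s : ℝ | s ∈ S ∧ 0 < p s ∧ p s < η} ∩ J)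
    (hb : b ∈ {s : ℝ | s ∈ S ∧ 0 < p s ∧ p s < η} ∩ J) (hab : a < b) :
    b - a ≤ η / K := by
  -- the whole segment `[a, b]` lies in the slice
  have hseg : Set.Icc a b ⊆ {s : ℝ | s ∈ S ∧ 0 < p s ∧ p s < η} := by
    intro c hc
    have hcJ : c ∈ J := hJ.out ha.2 hb.2 hc
    refine ⟨hS.out ha.1.1 hb.1.1 hc, ?_, ?_⟩
    · rcases hmono with h | h
      · exact lt_of_lt_of_le ha.1.2.1 (h ha.2 hcJ hc.1)
      · exact lt_of_lt_of_le hb.1.2.1 (h hcJ hb.2 hc.2)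
    · rcases hmono with h | h
      · exact lt_of_le_of_lt (h hcJ hb.2 hc.2) hb.1.2.2
      · exact lt_of_le_of_lt (h ha.2 hcJ hc.1) ha.1.2.2
  -- mean value theorem on `[a, b]`
  obtain ⟨ξ, hξ, hξeq⟩ := exists_hasDerivAt_eq_slope p p' hab
    (fun x _ => (hp x).continuousAt.continuousWithinAt) (fun x _ => hp x)
  have hKξ : K ≤ |p' ξ| := hder ξ (hseg (Set.Ioo_subset_Icc_self hξ))
  have hdiff : |p b - p a| < η := by
    have hpa0 := ha.1.2.1
    have hpaη := ha.1.2.2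
    have hpb0 := hb.1.2.1
    have hpbη := hb.1.2.2
    rw [abs_lt]
    constructor <;> linarith
  have hbapos : 0 < b - a := sub_pos.mpr hab
  have hslope : |p' ξ| * (b - a) < η := by
    rw [hξeq, abs_div, abs_of_pos hbapos, div_mul_cancel₀ _ hbapos.ne']
    exact hdiff
  rw [le_div_iff₀ hK]
  have hmul := mul_le_mul_of_nonneg_left hKξ hbapos.le
  nlinarith [hmul, hslope]

/-- Measure bound for the slice inside one monotonicity piece: `volume (T ∩ J) ≤ η / K`, since
`volume ≤ ediam` on `ℝ` and any two points of `T ∩ J` are at distance `≤ η / K`. -/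
private theorem SublevelSmall.volume_piece_le {p p' : ℝ → ℝ} {S J : Set ℝ} {η K : ℝ} (hK : 0 < K)
    (hp : ∀ x, HasDerivAt p (p' x) x) (hS : S.OrdConnected) (hJ : J.OrdConnected)
    (hmono : MonotoneOn p J ∨ AntitoneOn p J)
    (hder : ∀ s ∈ {s : ℝ | s ∈ S ∧ 0 < p s ∧ p s < η}, K ≤ |p' s|) :
    volume ({s : ℝ | s ∈ S ∧ 0 < p s ∧ p s < η} ∩ J) ≤ ENNReal.ofReal (η / K) := by
  refine (Real.volume_le_diam _).trans (Metric.ediam_le_of_forall_dist_le fun x hx y hy => ?_)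
  rcases lt_trichotomy x y with h | h | h
  · rw [Real.dist_eq, abs_sub_comm, abs_of_pos (sub_pos.2 h)]
    exact SublevelSmall.sub_le hK hp hS hJ hmono hder hx hy h
  · subst h
    rw [dist_self]
    exact div_nonneg (by linarith [hx.1.2.1, hx.1.2.2]) hK.le
  · rw [Real.dist_eq, abs_of_pos (sub_pos.2 h)]
    exact SublevelSmall.sub_le hK hp hS hJ hmono hder hy hx h

/-! ### The normalized cubic `p(s) = 4 s³ − G₂ s − G₃` -/

/-- `p'(s) = 12 s² − G₂`. -/
private theorem SublevelSmall.hasDerivAt_cubic (G₂ G₃ s : ℝ) :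
    HasDerivAt (fun x : ℝ => 4 * x ^ 3 - G₂ * x - G₃) (12 * s ^ 2 - G₂) s := by
  have h3 : HasDerivAt (fun x : ℝ => x ^ 3) (3 * s ^ 2) s := by
    simpa using hasDerivAt_pow 3 s
  have h : HasDerivAt (fun x : ℝ => 4 * x ^ 3 - G₂ * x - G₃) (4 * (3 * s ^ 2) - G₂ * 1) s :=
    ((h3.const_mul 4).sub ((hasDerivAt_id' s).const_mul G₂)).sub_const G₃
  exact h.congr_deriv (by ring)

/-- Resultant bound: for `s ∈ [−2,2]` with `0 < p(s) < η ≤ |D| / 126` one has `|D| ≤ 86 |p'(s)|`,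
from `(−18 G₂ s + 27 G₃)·p + (6 G₂ s² − 9 G₃ s − G₂²)·p' = D` and the cofactor bounds `63`, `43`. -/
private theorem SublevelSmall.disc_le {G₂ G₃ η s : ℝ} (hG₂ : |G₂| ≤ 1) (hG₃ : |G₃| ≤ 1)
    (hη : η ≤ 1 / 126 * |G₂ ^ 3 - 27 * G₃ ^ 2|) (hs : s ∈ Set.Icc (-2 : ℝ) 2)
    (hp0 : 0 < 4 * s ^ 3 - G₂ * s - G₃) (hpη : 4 * s ^ 3 - G₂ * s - G₃ < η) :
    |G₂ ^ 3 - 27 * G₃ ^ 2| ≤ 86 * |12 * s ^ 2 - G₂| := by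
  obtain ⟨hs1, hs2⟩ := hs
  have hsabs : |s| ≤ 2 := abs_le.mpr ⟨hs1, hs2⟩
  have h1 : |G₂ * s| ≤ 2 := by
    rw [abs_mul]
    exact (mul_le_mul hG₂ hsabs (abs_nonneg _) zero_le_one).trans_eq (one_mul _)
  have h2 : |G₃ * s| ≤ 2 := by
    rw [abs_mul]
    exact (mul_le_mul hG₃ hsabs (abs_nonneg _) zero_le_one).trans_eq (one_mul _)
  have hs2abs : |s ^ 2| ≤ 4 := by
    rw [abs_pow]
    nlinarith [abs_nonneg s]
  have h3 : |G₂ * s ^ 2| ≤ 4 := by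
    rw [abs_mul]
    exact (mul_le_mul hG₂ hs2abs (abs_nonneg _) zero_le_one).trans_eq (one_mul _)
  have h4 : |G₂ ^ 2| ≤ 1 := by
    rw [abs_pow]
    nlinarith [abs_nonneg G₂]
  obtain ⟨h1l, h1u⟩ := abs_le.mp h1
  obtain ⟨h2l, h2u⟩ := abs_le.mp h2
  obtain ⟨h3l, h3u⟩ := abs_le.mp h3
  obtain ⟨h4l, h4u⟩ := abs_le.mp h4
  obtain ⟨hG₃l, hG₃u⟩ := abs_le.mp hG₃
  have hA : |-18 * G₂ * s + 27 * G₃| ≤ 63 := by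
    rw [abs_le]
    constructor <;> linarith
  have hB : |6 * G₂ * s ^ 2 - 9 * G₃ * s - G₂ ^ 2| ≤ 43 := by
    rw [abs_le]
    constructor <;> linarith
  have hpabs : |4 * s ^ 3 - G₂ * s - G₃| ≤ η := abs_le.mpr ⟨by linarith, hpη.le⟩
  have hid : G₂ ^ 3 - 27 * G₃ ^ 2 = (-18 * G₂ * s + 27 * G₃) * (4 * s ^ 3 - G₂ * s - G₃) +
      (6 * G₂ * s ^ 2 - 9 * G₃ * s - G₂ ^ 2) * (12 * s ^ 2 - G₂) := by
    ring
  have hD : |G₂ ^ 3 - 27 * G₃ ^ 2| ≤ 63 * η + 43 * |12 * s ^ 2 - G₂| := by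
    rw [hid]
    refine (abs_add_le _ _).trans ?_
    rw [abs_mul, abs_mul]
    gcongr
  linarith

/-- The left outer piece `{s ≤ 0, p' > 0}` is order-connected and `p` is monotone on it. -/
private theorem SublevelSmall.pieceL_spec (G₂ G₃ : ℝ) :
    ({s : ℝ | s ≤ 0 ∧ 0 < 12 * s ^ 2 - G₂}).OrdConnected ∧
      MonotoneOn (fun x : ℝ => 4 * x ^ 3 - G₂ * x - G₃) {s : ℝ | s ≤ 0 ∧ 0 < 12 * s ^ 2 - G₂} := by
  have hoc : ({s : ℝ | s ≤ 0 ∧ 0 < 12 * s ^ 2 - G₂}).OrdConnected := by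
    refine ⟨fun x _ y hy z hz => ⟨hz.2.trans hy.1, ?_⟩⟩
    have hy1 := hy.1
    have hy2 := hy.2
    have hz2 := hz.2
    nlinarith
  refine ⟨hoc, monotoneOn_of_hasDerivWithinAt_nonneg hoc.convex
    (fun x _ => (SublevelSmall.hasDerivAt_cubic G₂ G₃ x).continuousAt.continuousWithinAt)
    (fun x _ => (SublevelSmall.hasDerivAt_cubic G₂ G₃ x).hasDerivWithinAt) fun x hx => ?_⟩
  exact (interior_subset hx : x ∈ {s : ℝ | s ≤ 0 ∧ 0 < 12 * s ^ 2 - G₂}).2.le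

/-- The middle piece `{p' < 0}` is order-connected and `p` is antitone on it. -/
private theorem SublevelSmall.pieceM_spec (G₂ G₃ : ℝ) :
    ({s : ℝ | 12 * s ^ 2 - G₂ < 0}).OrdConnected ∧
      AntitoneOn (fun x : ℝ => 4 * x ^ 3 - G₂ * x - G₃) {s : ℝ | 12 * s ^ 2 - G₂ < 0} := by
  have hoc : ({s : ℝ | 12 * s ^ 2 - G₂ < 0}).OrdConnected := by
    refine ⟨fun x hx y hy z hz => ?_⟩
    have hx' : 12 * x ^ 2 - G₂ < 0 := hx
    have hy' : 12 * y ^ 2 - G₂ < 0 := hy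
    show 12 * z ^ 2 - G₂ < 0
    obtain ⟨hz1, hz2⟩ := hz
    rcases le_total 0 z with h | h
    · nlinarith
    · nlinarith
  refine ⟨hoc, antitoneOn_of_hasDerivWithinAt_nonpos hoc.convex
    (fun x _ => (SublevelSmall.hasDerivAt_cubic G₂ G₃ x).continuousAt.continuousWithinAt)
    (fun x _ => (SublevelSmall.hasDerivAt_cubic G₂ G₃ x).hasDerivWithinAt) fun x hx => ?_⟩
  have hx' : x ∈ {s : ℝ | 12 * s ^ 2 - G₂ < 0} := interior_subset hx
  exact le_of_lt hx'

/-- The right outer piece `{0 ≤ s, p' > 0}` is order-connected and `p` is monotone on it. -/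
private theorem SublevelSmall.pieceR_spec (G₂ G₃ : ℝ) :
    ({s : ℝ | 0 ≤ s ∧ 0 < 12 * s ^ 2 - G₂}).OrdConnected ∧
      MonotoneOn (fun x : ℝ => 4 * x ^ 3 - G₂ * x - G₃) {s : ℝ | 0 ≤ s ∧ 0 < 12 * s ^ 2 - G₂} := by
  have hoc : ({s : ℝ | 0 ≤ s ∧ 0 < 12 * s ^ 2 - G₂}).OrdConnected := by
    refine ⟨fun x hx y _ z hz => ⟨hx.1.trans hz.1, ?_⟩⟩
    have hx1 := hx.1
    have hx2 := hx.2
    have hz1 := hz.1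
    nlinarith
  refine ⟨hoc, monotoneOn_of_hasDerivWithinAt_nonneg hoc.convex
    (fun x _ => (SublevelSmall.hasDerivAt_cubic G₂ G₃ x).continuousAt.continuousWithinAt)
    (fun x _ => (SublevelSmall.hasDerivAt_cubic G₂ G₃ x).hasDerivWithinAt) fun x hx => ?_⟩
  exact (interior_subset hx : x ∈ {s : ℝ | 0 ≤ s ∧ 0 < 12 * s ^ 2 - G₂}).2.le

/-- **Stub B1 — first-derivative sublevel-set estimate for normalized cubics.**  There are
absolute constants `c₁, C₁ > 0` (here `c₁ = 1/126`, `C₁ = 258`) such that for the normalized cubic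
`p(s) = 4s³ − G₂ s − G₃` with `|G₂|, |G₃| ≤ 1` and discriminant `D = G₂³ − 27G₃²`, the thin slice
`{s ∈ [−2,2] : 0 < p(s) < η}` has Lebesgue measure `≤ C₁ η / |D|` whenever `0 < η ≤ c₁ |D|`.
Proof: the resultant identity `(−18G₂s + 27G₃)p + (6G₂s² − 9G₃s − G₂²)p' = D` gives
`|p'| ≥ |D|/86` on the slice; `p` is monotone on the three pieces cut out by the sign of
`p' = 12s² − G₂`, so inside each piece the slice has diameter `≤ 86η/|D|` (mean value theorem),
and `volume ≤ ediam`. [folklore] -/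
theorem stub_sublevelSmall :
    ∃ c₁ C₁ : ℝ, 0 < c₁ ∧ 0 < C₁ ∧ ∀ G₂ G₃ η : ℝ, |G₂| ≤ 1 → |G₃| ≤ 1 → 0 < η →
      η ≤ c₁ * |G₂ ^ 3 - 27 * G₃ ^ 2| →
        volume {s : ℝ | s ∈ Set.Icc (-2 : ℝ) 2 ∧ 0 < 4 * s ^ 3 - G₂ * s - G₃ ∧
            4 * s ^ 3 - G₂ * s - G₃ < η} ≤
          ENNReal.ofReal (C₁ * η / |G₂ ^ 3 - 27 * G₃ ^ 2|) := by
  refine ⟨1 / 126, 258, by norm_num, by norm_num, fun G₂ G₃ η hG₂ hG₃ hη₀ hη => ?_⟩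
  have hDpos : 0 < |G₂ ^ 3 - 27 * G₃ ^ 2| := by linarith
  have hK : 0 < |G₂ ^ 3 - 27 * G₃ ^ 2| / 86 := by positivity
  set T : Set ℝ := {s : ℝ | s ∈ Set.Icc (-2 : ℝ) 2 ∧ 0 < 4 * s ^ 3 - G₂ * s - G₃ ∧
    4 * s ^ 3 - G₂ * s - G₃ < η}
  set L : Set ℝ := {s : ℝ | s ≤ 0 ∧ 0 < 12 * s ^ 2 - G₂}
  set M : Set ℝ := {s : ℝ | 12 * s ^ 2 - G₂ < 0}
  set R : Set ℝ := {s : ℝ | 0 ≤ s ∧ 0 < 12 * s ^ 2 - G₂}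
  -- `|p'| ≥ |D| / 86` on the slice
  have hder : ∀ s ∈ T, |G₂ ^ 3 - 27 * G₃ ^ 2| / 86 ≤ |12 * s ^ 2 - G₂| := fun s hs => by
    have := SublevelSmall.disc_le hG₂ hG₃ hη hs.1 hs.2.1 hs.2.2
    linarith
  -- the three pieces cover the slice
  have hcover : T ⊆ (T ∩ L ∪ T ∩ M) ∪ T ∩ R := by
    intro s hs
    have hq : 12 * s ^ 2 - G₂ ≠ 0 := fun h => by
      have := hder s hs
      rw [h, abs_zero] at this
      linarith
    rcases hq.lt_or_gt with hlt | hgt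
    · exact Or.inl (Or.inr ⟨hs, hlt⟩)
    · rcases le_total s 0 with hs0 | hs0
      · exact Or.inl (Or.inl ⟨hs, hs0, hgt⟩)
      · exact Or.inr ⟨hs, hs0, hgt⟩
  -- measure of each piece
  have hp := SublevelSmall.hasDerivAt_cubic G₂ G₃
  obtain ⟨hLo, hLm⟩ := SublevelSmall.pieceL_spec G₂ G₃
  obtain ⟨hMo, hMm⟩ := SublevelSmall.pieceM_spec G₂ G₃
  obtain ⟨hRo, hRm⟩ := SublevelSmall.pieceR_spec G₂ G₃
  have hconv : η / (|G₂ ^ 3 - 27 * G₃ ^ 2| / 86) = 86 * η / |G₂ ^ 3 - 27 * G₃ ^ 2| := by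
    rw [div_div_eq_mul_div, mul_comm]
  have hvL : volume (T ∩ L) ≤ ENNReal.ofReal (86 * η / |G₂ ^ 3 - 27 * G₃ ^ 2|) :=
    hconv ▸ SublevelSmall.volume_piece_le hK hp Set.ordConnected_Icc hLo (Or.inl hLm) hder
  have hvM : volume (T ∩ M) ≤ ENNReal.ofReal (86 * η / |G₂ ^ 3 - 27 * G₃ ^ 2|) :=
    hconv ▸ SublevelSmall.volume_piece_le hK hp Set.ordConnected_Icc hMo (Or.inr hMm) hder
  have hvR : volume (T ∩ R) ≤ ENNReal.ofReal (86 * η / |G₂ ^ 3 - 27 * G₃ ^ 2|) :=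
    hconv ▸ SublevelSmall.volume_piece_le hK hp Set.ordConnected_Icc hRo (Or.inl hRm) hder
  have h86 : 0 ≤ 86 * η / |G₂ ^ 3 - 27 * G₃ ^ 2| := by positivity
  calc volume T
      ≤ volume ((T ∩ L ∪ T ∩ M) ∪ T ∩ R) := measure_mono hcover
    _ ≤ volume (T ∩ L ∪ T ∩ M) + volume (T ∩ R) := measure_union_le _ _
    _ ≤ volume (T ∩ L) + volume (T ∩ M) + volume (T ∩ R) :=
        add_le_add (measure_union_le _ _) le_rfl
    _ ≤ ENNReal.ofReal (86 * η / |G₂ ^ 3 - 27 * G₃ ^ 2|) +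
            ENNReal.ofReal (86 * η / |G₂ ^ 3 - 27 * G₃ ^ 2|) +
          ENNReal.ofReal (86 * η / |G₂ ^ 3 - 27 * G₃ ^ 2|) := add_le_add (add_le_add hvL hvM) hvR
    _ = ENNReal.ofReal (258 * η / |G₂ ^ 3 - 27 * G₃ ^ 2|) := by
        rw [← ENNReal.ofReal_add h86 h86, ← ENNReal.ofReal_add (add_nonneg h86 h86) h86]
        congr 1
        ring

end Summit.ABC.ABC.Theorems

end
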